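import Summits.QuantumFields.YangMills.Theorems.UnitScaleTiltProp8HalvingDressingLetterChartOfRecord
import Summits.QuantumFields.YangMills.Theorems.UnitScaleTiltProp8ChartRemainderColumnLetterFlat
import HarnessLib

/-!
# Route `UnitScaleTilt`, crux K1 child «MinimiserStabilityRegPr» (stmt-QuantumFields-19200), registered stub V2′ `stub_halvingStep`
# (skeleton v10 `BirthV10`) — **THE DRESSING LETTER `C_E` ON THE CHART OF RECORD, NUMERIC WINDOW DISCHARGED AND (X2-C′)♭ READ FROM THE (157)♭ KERNEL ROW
# (FILE E v2)** — ✓ p616882 FILE E `exists_hWq_dressed_cubeSeq_T3_chartOfRecord` with its eight numeric window rows SUPPLIED (§1, explicit `ε, R_c⁰, a₃` from `L` and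
# the (157)♭ slope `C₃`) and its (X2-C′)♭ ball-letter binder READ from the per-READ-bond kernel row (157)♭ via ★w8-19936 g0's ✓ p616686
# `ChartRemainderColumnLetterFlat.hCcolFlatBall_of_readKernel157` (the (c3) adapter) — so that the C_E node's ONLY displayed input is (S4′)'s (157)♭ read-kernel row
# `hKball` on an `R′`-ball, `R′ ≤ R_s/4` (★w5-19936 g3's F3d ⧗p617042 `kernel157_flat`, whose four `ρ`-windows fix `R′(L)`), and the output is a member-uniform `a₃ > 0` with hypothesis (iii) of the (165)-A₁ row below it

Cell `ym3-torus` (HUMAN RULING D-0037, YM ladder rung R3 — continuum SU(2) YM₃ on the torus is a RUNG, not the Clay problem), width seat `ym-ust-19200-w6`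
(D-0154 (3c); ★★OWNER ym3-torus-plan g26 RULINGS g26-№6∕№7∕№11∕№16 (census #53: S7∕S8∕S10)).  `--supports stmt-QuantumFields-19200 --as helper`; count-neutral;
def-free, 0 sorry, standard axioms.

WHAT THIS FILE PROVES (sorry-free; no definition):
* §1 `exists_CE_window` — pure real arithmetic: the window of FILE E is inhabited by explicit `ε := min (R_s/12) (1/(2(9C₂B_H+1))) (1/(3(C₃K₀+1)))`,
  `R_c⁰ := ε/2`, `a₃ := min (ε/2) (1/(4L))`.
* §2 ★★★ **`exists_hWq_dressed_cubeSeq_T3_chartOfRecord_ofKernelRow`** — for odd `L = ℓ + 1 ≥ 5`: `∃ M_h⁰ R₀ (B_H C_X K₀ C_P ≥ 0)` (from `L`) such that for every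
  (157)♭ slope `C₃ ≥ 0` and ball radius `0 < R′ ≤ R_s/4` (both from `L` alone in (S4′)'s F3d) there are `ε, R_c⁰, a₃` with `0 < a₃ ≤ R_c⁰ < ε`, `3ε ≤ R_s/4`, `9C₂B_Hε < 1`, `(1 + 4B_HC₂R_c⁰)a₃ ≤ 1/(2L)` (functions of `L` and `C₃`
  alone) such that at every member∕height∕admissible cube sequence (FILE E's binders) the (157)♭ READ-bond kernel row of `C♭` on the `R′`-ball at slope `C₃`
  (`hCcolFlatBall_of_readKernel157`'s `hKball` VERBATIM) yields FILE E's full output: `Hs` (display, `hHinv`, (46) rows), `Dsel` (analytic, (55)∕(49)∕(48)∕uniqueness,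
  FILE C's four regularity binders, (73)) and P3b's `W₀` with `w₃(b)·‖(W₀(Y − Hs(Dsel Y)) + E Y)(b)‖ ≤ C₄·r²` for every `Y` of size `r < a₃` and the EXPLICIT `E` —
  `C₄ = C₀θ² + 2C_XC₂ + ½(8·C₃′·2C_P)θ + 16K₀C₃′R_c⁰C₀θ²`, `C₃′ = 7C₃(1 + 4B_HC₂ε)`, `θ = 1 + 4B_HC₂R_c⁰`, `C₀ = 12L³(1428 + L)`, `C₂ = 64L/R_s`,
  `R_s = (16·3800·(5L)²·L)⁻¹`.
HONEST SCOPE.  Plumbing: FILE E ∘ §1 ∘ ✓ p616686 ∘ ✓ p613442 (B3's differentiability on the ball); the (157)♭ read-kernel row itself ((S4′) F3d) is NOT proved here.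
NOT a claim about the stub, the crux, the rung or the mass gap; no summit statement is proved by this seat.

References: T. Bałaban, CMP **102** (1985) 277–309 [Balaban1985Variational] (44)–(50) p.285, (55) p.286, (72)–(73) p.289, (80)–(89) pp.290–291, Prop. 4 (97)–(98)
pp.292–293, (144) p.300, (152)–(158) pp.301–302, (161)–(163) p.303; CMP **98** (1985) 17–51 [Balaban1985Averaging] Prop. 5 (156)–(157) p.42.
-/

set_option autoImplicit false

noncomputable section

open scoped BigOperators Matrix Matrix.Norms.L2Operator
open NormedSpace Filter Topology

namespace Summit.QuantumFields.YangMills.Theorems.HalvingDressingLetter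

open Literature.MathematicalPhysics.QuantumFieldTheory.Balaban1983to89
open B6GlobalChartV1 (PV)
open B6SectADomainsV1 (Domains)
open B6SectAOperatorsV1 (BondIdx)
open B5Eq118OneStroke (iterBlockOf)
open T3ContinuumYM3Torus (T3Family)
open FlatCubeOpsText (Adm22 IsLevWeight)
open FlatOpsLettersAssembly (flatH)
open FlatCubeSequenceAligned (cubeSeqMT3 cubeSeqMT3_k)
open FlatCubeSequenceAdm (adm22_cubeSeqMT3)
open Prop8ChartDoubleBar (chartLogFlat chartRemainderFlat_hCd_hCq_B1)
open ChartRemainderColumnLetterFlat (hCcolFlatBall_of_readKernel157)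

/-! ## §1 A numeric window for the C_E knit -/

/-- **A NUMERIC WINDOW FOR FILE E** (pure real arithmetic): for a ball radius `0 < R′ ≤ R_s/4`, `C₂, B_H, K₀, C₃ ≥ 0`, `L > 0` there are `ε, R_c⁰, a₃` with
`0 < a₃ ≤ R_c⁰ < ε`, `3ε ≤ R_s/4`, `9C₂B_Hε < 1`, `(1 + 4B_HC₂ε)ε ≤ R′`, `C₃(1 + 4B_HC₂ε)εK₀ ≤ ½`, `(1 + 4B_HC₂R_c⁰)a₃ ≤ 1/(2L)` — the eight window rows of
`exists_hWq_dressed_cubeSeq_T3_chartOfRecord` (`ε := min (R′/3) (1/(2(9C₂B_H+1))) (1/(3(C₃K₀+1)))`, `R_c⁰ := ε/2`, `a₃ := min (ε/2) (1/(4L))`).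
[cite: Balaban1985Variational, Prop. 3 p.289, (55) p.286, Prop. 4 (97)-(98) pp.292-293] -/
theorem exists_CE_window {Rs R' C₂ BH K₀ C₃ L : ℝ} (hR' : 0 < R') (hR'Rs : R' ≤ Rs / 4) (hC₂ : 0 ≤ C₂) (hBH : 0 ≤ BH)
    (hK₀ : 0 ≤ K₀) (hC₃ : 0 ≤ C₃) (hL : 0 < L) :
    ∃ ε Rc₀ a₃ : ℝ, 0 < a₃ ∧ 0 < ε ∧ 3 * ε ≤ Rs / 4 ∧ 9 * C₂ * BH * ε < 1 ∧
      (1 + 4 * BH * C₂ * ε) * ε ≤ R' ∧ C₃ * (1 + 4 * BH * C₂ * ε) * ε * K₀ ≤ 1 / 2 ∧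
      0 ≤ Rc₀ ∧ Rc₀ < ε ∧ a₃ ≤ Rc₀ ∧ (1 + 4 * BH * C₂ * Rc₀) * a₃ ≤ 1 / (2 * L) := by
  -- the chart radius: below `R'/3`, below `1/(2(9C₂B_H + 1))`, below `1/(3(C₃K₀ + 1))`
  set ε : ℝ := min (R' / 3) (min (1 / (2 * (9 * C₂ * BH + 1))) (1 / (3 * (C₃ * K₀ + 1)))) with hε_def
  have hA : 0 < 9 * C₂ * BH + 1 := by positivity
  have hB : 0 < C₃ * K₀ + 1 := by positivity
  have hε0 : 0 < ε := by
    rw [hε_def]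
    exact lt_min (by positivity) (lt_min (by positivity) (by positivity))
  have hε1 : ε ≤ R' / 3 := min_le_left _ _
  have hε2 : ε ≤ 1 / (2 * (9 * C₂ * BH + 1)) := (min_le_right _ _).trans (min_le_left _ _)
  have hε3 : ε ≤ 1 / (3 * (C₃ * K₀ + 1)) := (min_le_right _ _).trans (min_le_right _ _)
  -- `9C₂B_Hε ≤ 1/2`
  have hq : 9 * C₂ * BH * ε ≤ 1 / 2 := by
    have h1 : 9 * C₂ * BH * ε ≤ 9 * C₂ * BH * (1 / (2 * (9 * C₂ * BH + 1))) :=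
      mul_le_mul_of_nonneg_left hε2 (by positivity)
    have h2 : 9 * C₂ * BH * (1 / (2 * (9 * C₂ * BH + 1))) ≤ 1 / 2 := by
      rw [mul_one_div, div_le_div_iff₀ (by positivity) (by norm_num)]
      nlinarith
    exact h1.trans h2
  have hθ : 1 + 4 * BH * C₂ * ε ≤ 3 / 2 := by nlinarith
  have hθ0 : 0 ≤ 4 * BH * C₂ * ε := by positivity
  -- `C₃K₀ε ≤ 1/3`
  have hc : C₃ * K₀ * ε ≤ 1 / 3 := by
    have h1 : C₃ * K₀ * ε ≤ C₃ * K₀ * (1 / (3 * (C₃ * K₀ + 1))) := mul_le_mul_of_nonneg_left hε3 (by positivity)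
    have h2 : C₃ * K₀ * (1 / (3 * (C₃ * K₀ + 1))) ≤ 1 / 3 := by
      rw [mul_one_div, div_le_div_iff₀ (by positivity) (by norm_num)]
      nlinarith
    exact h1.trans h2
  refine ⟨ε, ε / 2, min (ε / 2) (1 / (4 * L)), lt_min (by positivity) (by positivity), hε0, by linarith, by linarith, ?_, ?_,
    by positivity, by linarith, min_le_left _ _, ?_⟩
  · -- `(1 + 4B_HC₂ε)ε ≤ (3/2)ε ≤ Rs/4`
    nlinarith
  · -- `C₃θεK₀ ≤ (3/2)·C₃K₀ε ≤ 1/2`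
    have : C₃ * (1 + 4 * BH * C₂ * ε) * ε * K₀ = (1 + 4 * BH * C₂ * ε) * (C₃ * K₀ * ε) := by ring
    rw [this]
    nlinarith [mul_nonneg (mul_nonneg hC₃ hK₀) hε0.le]
  · -- `(1 + 4B_HC₂ε/2)·min(ε/2, 1/(4L)) ≤ (3/2)·(1/(4L)) ≤ 1/(2L)`
    have hθ' : 1 + 4 * BH * C₂ * (ε / 2) ≤ 3 / 2 := by nlinarith
    have hθ'0 : 0 ≤ 1 + 4 * BH * C₂ * (ε / 2) := by positivity
    have hm : min (ε / 2) (1 / (4 * L)) ≤ 1 / (4 * L) := min_le_right _ _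
    have hm0 : 0 ≤ min (ε / 2) (1 / (4 * L)) := le_min (by positivity) (by positivity)
    calc (1 + 4 * BH * C₂ * (ε / 2)) * min (ε / 2) (1 / (4 * L)) ≤ (3 / 2) * (1 / (4 * L)) :=
          mul_le_mul hθ' hm hm0 (by norm_num)
      _ ≤ 1 / (2 * L) := by
          have e1 : (3 : ℝ) / 2 * (1 / (4 * L)) = 3 / (8 * L) := by field_simp; ring
          rw [e1, div_le_div_iff₀ (by positivity) (by positivity)]
          nlinarith

/-! ## §2 FILE E with the window supplied and (X2-C′)♭ read from the (157)♭ kernel row -/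

/-- `1 ≤ 3` (named once; every `PV` below carries the same proof term). [folklore] -/
private theorem hd3 : 1 ≤ 2 + 1 := by norm_num

-- heartbeat budget (HOME README rule): FILE E-sized signature (> 100 lines); budgeted 400k on this declaration only
set_option maxHeartbeats 400000 in
/-- ★★★ **THE C_E KNIT ON THE CHART OF RECORD FROM THE (157)♭ READ-KERNEL ROW ALONE** — see the module docstring: FILE E's numeric window supplied by §1
(`R′ := R_s/4`) and its (X2-C′)♭ ball letter read from `hKball` by ✓ `hCcolFlatBall_of_readKernel157` (slope `7C₃`); the index weight is the record's
`u(i) = η⁻³(L^{j(i)}η)⁻¹`. [cite: Balaban1985Variational, (44)-(50) p.285, (55) p.286, (72)-(73) p.289, (80)-(89) pp.290-291, Prop. 4 (97)-(98) pp.292-293, (144) p.300, (152)-(158) pp.301-302, (161)-(163) p.303; Balaban1985Averaging, Prop. 5 (157) p.42] -/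
theorem exists_hWq_dressed_cubeSeq_T3_chartOfRecord_ofKernelRow (ℓ : ℕ) (hL : Odd (ℓ + 1) ∧ 1 < ℓ + 1) (hℓ : 4 ≤ ℓ) :
    ∃ (Mh₀ R₀ : ℕ) (BH CX K₀ CP : ℝ), 0 ≤ BH ∧ 0 ≤ CX ∧ 0 ≤ K₀ ∧ 0 ≤ CP ∧
    ∀ (C₃ R' : ℝ), 0 ≤ C₃ → 0 < R' → R' ≤ (16 * 3800 * ((((2 + 1 + 2) * (ℓ + 1) : ℕ)) : ℝ) ^ 2 * ((ℓ + 1 : ℕ) : ℝ))⁻¹ / 4 → ∃ (ε Rc₀ a₃ : ℝ), 0 < a₃ ∧ a₃ ≤ Rc₀ ∧ Rc₀ < ε ∧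
      3 * ε ≤ (16 * 3800 * ((((2 + 1 + 2) * (ℓ + 1) : ℕ)) : ℝ) ^ 2 * ((ℓ + 1 : ℕ) : ℝ))⁻¹ / 4 ∧ 9 * (64 * ((ℓ + 1 : ℕ) : ℝ) / (16 * 3800 * ((((2 + 1 + 2) * (ℓ + 1) : ℕ)) : ℝ) ^ 2 * ((ℓ + 1 : ℕ) : ℝ))⁻¹) * BH * ε < 1 ∧ (1 + 4 * BH * (64 * ((ℓ + 1 : ℕ) : ℝ) / (16 * 3800 * ((((2 + 1 + 2) * (ℓ + 1) : ℕ)) : ℝ) ^ 2 * ((ℓ + 1 : ℕ) : ℝ))⁻¹) * ε) * ε ≤ R' ∧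
      (1 + 4 * BH * (64 * ((ℓ + 1 : ℕ) : ℝ) / (16 * 3800 * ((((2 + 1 + 2) * (ℓ + 1) : ℕ)) : ℝ) ^ 2 * ((ℓ + 1 : ℕ) : ℝ))⁻¹) * Rc₀) * a₃ ≤ 1 / (2 * ((ℓ + 1 : ℕ) : ℝ)) ∧
    ∀ (m : ℕ) (hm : 1 ≤ m) (n K : ℕ) (_ : 1 ≤ K - n) (_ : K - n + 1 ≤ m + K) {Mh R a' : ℕ} (_ : Mh = (ℓ + 1) ^ a') (_ : Mh₀ ≤ Mh) (_ : R₀ ≤ R)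
      (_ : a' + 3 ≤ m + n) (x₀ : Site (PV 2 ℓ m K hd3 hL) 0) (ρ S : ℕ) (hM : 1 ≤ (ℓ + 1) * Mh) (_ : R * ((ℓ + 1) * Mh) ≤ S)
      (w : ℕ → PBond (PV 2 ℓ m K hd3 hL) 0 → ℝ) (_ : IsLevWeight (⟨ℓ + 1, hL, m, hm⟩ : T3Family) n K (cubeSeqMT3 (⟨ℓ + 1, hL, m, hm⟩ : T3Family) n K x₀ ρ S ((ℓ + 1) * Mh) hM) w)
      (_ : ∀ (Z : PBond (PV 2 ℓ m K hd3 hL) 0 → Matrix (Fin 2) (Fin 2) ℂ) (ρ' : ℝ), 0 ≤ ρ' → ρ' < R' → (∀ b, w 1 b * ‖Z b‖ ≤ ρ') →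
        ∀ (b : PBond (PV 2 ℓ m K hd3 hL) 0) (M : Matrix (Fin 2) (Fin 2) ℂ) (i : BondIdx (cubeSeqMT3 (⟨ℓ + 1, hL, m, hm⟩ : T3Family) n K x₀ ρ S ((ℓ + 1) * Mh) hM)),
        ((iterBlockOf (i.1.1 : ℕ) b.src = i.1.2.src ∨ iterBlockOf (i.1.1 : ℕ) b.src = i.1.2.tgt) ∧
          (iterBlockOf (i.1.1 : ℕ) b.tgt = i.1.2.src ∨ iterBlockOf (i.1.1 : ℕ) b.tgt = i.1.2.tgt)) →
        ‖fderiv ℂ (fun A : PBond (PV 2 ℓ m K hd3 hL) 0 → Matrix (Fin 2) (Fin 2) ℂ => chartLogFlat (((((ℓ + 1 : ℕ) : ℝ))⁻¹) ^ (K - n)) (cubeSeqMT3 (⟨ℓ + 1, hL, m, hm⟩ : T3Family) n K x₀ ρ S ((ℓ + 1) * Mh) hM) A - fderiv ℂ (chartLogFlat (((((ℓ + 1 : ℕ) : ℝ))⁻¹) ^ (K - n)) (cubeSeqMT3 (⟨ℓ + 1, hL, m, hm⟩ : T3Family) n K x₀ ρ S ((ℓ + 1) * Mh) hM) : (PBond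 (PV 2 ℓ m K hd3 hL) 0 → Matrix (Fin 2) (Fin 2) ℂ) → BondIdx (cubeSeqMT3 (⟨ℓ + 1, hL, m, hm⟩ : T3Family) n K x₀ ρ S ((ℓ + 1) * Mh) hM) → Matrix (Fin 2) (Fin 2) ℂ) 0 A) Z (Pi.single b M) i‖ ≤
          C₃ * ρ' * (((((ℓ + 1 : ℕ) : ℝ))⁻¹) ^ (K - n)) * (((((ℓ + 1 : ℕ) : ℝ)) ^ (i.1.1 : ℕ))⁻¹) ^ 2 * ‖M‖),
    ∃ (Hs : (BondIdx (cubeSeqMT3 (⟨ℓ + 1, hL, m, hm⟩ : T3Family) n K x₀ ρ S ((ℓ + 1) * Mh) hM) → Matrix (Fin 2) (Fin 2) ℂ) →ₗ[ℂ] (PBond (PV 2 ℓ m K hd3 hL) 0 → Matrix (Fin 2) (Fin 2) ℂ))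
      (Dsel : (PBond (PV 2 ℓ m K hd3 hL) 0 → Matrix (Fin 2) (Fin 2) ℂ) → BondIdx (cubeSeqMT3 (⟨ℓ + 1, hL, m, hm⟩ : T3Family) n K x₀ ρ S ((ℓ + 1) * Mh) hM) → Matrix (Fin 2) (Fin 2) ℂ)
      (W₀ : (PBond (PV 2 ℓ m K hd3 hL) 0 → Matrix (Fin 2) (Fin 2) ℂ) → (PBond (PV 2 ℓ m K hd3 hL) 0 → Matrix (Fin 2) (Fin 2) ℂ)),
      (∀ (X : BondIdx (cubeSeqMT3 (⟨ℓ + 1, hL, m, hm⟩ : T3Family) n K x₀ ρ S ((ℓ + 1) * Mh) hM) → Matrix (Fin 2) (Fin 2) ℂ) (b : PBond (PV 2 ℓ m K hd3 hL) 0),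
        Hs X b = ∑ c : BondIdx (cubeSeqMT3 (⟨ℓ + 1, hL, m, hm⟩ : T3Family) n K x₀ ρ S ((ℓ + 1) * Mh) hM), (flatH (⟨ℓ + 1, hL, m, hm⟩ : T3Family) n K (cubeSeqMT3 (⟨ℓ + 1, hL, m, hm⟩ : T3Family) n K x₀ ρ S ((ℓ + 1) * Mh) hM) (Pi.single c 1) b * ((((ℓ + 1 : ℕ) : ℝ)) ^ (c.1.1 : ℕ) * ((((ℓ + 1 : ℕ) : ℝ))⁻¹) ^ (K - n))⁻¹) • X c) ∧
      (∀ X : BondIdx (cubeSeqMT3 (⟨ℓ + 1, hL, m, hm⟩ : T3Family) n K x₀ ρ S ((ℓ + 1) * Mh) hM) → Matrix (Fin 2) (Fin 2) ℂ, (fderiv ℂ (chartLogFlat (((((ℓ + 1 : ℕ) : ℝ))⁻¹) ^ (K - n)) (cubeSeqMT3 (⟨ℓ + 1, hL, m, hm⟩ : T3Family) n K x₀ ρ S ((ℓ + 1) * Mh) hM) : (PBond (PV 2 ℓ m K hd3 hL) 0 → Matrix (Fin 2) (Fin 2) ℂ) → BondIdx (cubeSeqMT3 (⟨ℓ + 1,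 hL, m, hm⟩ : T3Family) n K x₀ ρ S ((ℓ + 1) * Mh) hM) → Matrix (Fin 2) (Fin 2) ℂ) 0) (Hs X) = X) ∧
      (∀ (X : BondIdx (cubeSeqMT3 (⟨ℓ + 1, hL, m, hm⟩ : T3Family) n K x₀ ρ S ((ℓ + 1) * Mh) hM) → Matrix (Fin 2) (Fin 2) ℂ) (t : ℝ), (∀ c, ‖X c‖ ≤ t) →
        (∀ b, w 1 b * ‖Hs X b‖ ≤ BH * t) ∧
        ∀ (b : PBond (PV 2 ℓ m K hd3 hL) 0) (ν : Fin 3), w 2 b * ((ℓ + 1 : ℕ) : ℝ) ^ (K - n) * ‖Hs X ⟨b.src.shift ν, b.dir⟩ - Hs X b‖ ≤ BH * t) ∧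
      AnalyticOnNhd ℂ Dsel {A' : PBond (PV 2 ℓ m K hd3 hL) 0 → Matrix (Fin 2) (Fin 2) ℂ | ∀ b, w 1 b * ‖A' b‖ < ε} ∧
      DifferentiableOn ℂ (fderiv ℂ Dsel) {A' : PBond (PV 2 ℓ m K hd3 hL) 0 → Matrix (Fin 2) (Fin 2) ℂ | ∀ b, w 1 b * ‖A' b‖ < ε} ∧
      (∀ A' : PBond (PV 2 ℓ m K hd3 hL) 0 → Matrix (Fin 2) (Fin 2) ℂ, (∀ b, w 1 b * ‖A' b‖ < ε) →
        (∀ c, ‖Dsel A' c‖ ≤ 4 * (64 * ((ℓ + 1 : ℕ) : ℝ) / (16 * 3800 * (((((PV 2 ℓ m K hd3 hL)).d + 2) * ((PV 2 ℓ m K hd3 hL)).L : ℕ) : ℝ) ^ 2 * ((ℓ + 1 : ℕ) : ℝ))⁻¹) * ε ^ 2) ∧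
        chartLogFlat (((((ℓ + 1 : ℕ) : ℝ))⁻¹) ^ (K - n)) (cubeSeqMT3 (⟨ℓ + 1, hL, m, hm⟩ : T3Family) n K x₀ ρ S ((ℓ + 1) * Mh) hM) (A' - Hs (Dsel A')) - (fderiv ℂ (chartLogFlat (((((ℓ + 1 : ℕ) : ℝ))⁻¹) ^ (K - n)) (cubeSeqMT3 (⟨ℓ + 1, hL, m, hm⟩ : T3Family) n K x₀ ρ S ((ℓ + 1) * Mh) hM) : (PBond (PV 2 ℓ m K hd3 hL) 0 → Matrix (Fin 2) (Fin 2) ℂ) → BondIdx (cubeSeqMT3 (⟨ℓ + 1, hL, m, hm⟩ : T3Family) n K x₀ ρ S ((ℓ + 1) * Mh) hM) → Matrix (Fin 2) (Fin 2) ℂ) 0) (A' - Hs (Dsel A')) = Dsel A' ∧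
        chartLogFlat (((((ℓ + 1 : ℕ) : ℝ))⁻¹) ^ (K - n)) (cubeSeqMT3 (⟨ℓ + 1, hL, m, hm⟩ : T3Family) n K x₀ ρ S ((ℓ + 1) * Mh) hM) (A' - Hs (Dsel A')) = (fderiv ℂ (chartLogFlat (((((ℓ + 1 : ℕ) : ℝ))⁻¹) ^ (K - n)) (cubeSeqMT3 (⟨ℓ + 1, hL, m, hm⟩ : T3Family) n K x₀ ρ S ((ℓ + 1) * Mh) hM) : (PBond (PV 2 ℓ m K hd3 hL) 0 → Matrix (Fin 2) (Fin 2) ℂ) → BondIdx (cubeSeqMT3 (⟨ℓ + 1, hL, m, hm⟩ : T3Family) n K x₀ ρ S ((ℓ + 1) * Mh) hM) → Matrix (Fin 2) (Fin 2) ℂ) 0) A' ∧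
        (∀ D' : BondIdx (cubeSeqMT3 (⟨ℓ + 1, hL, m, hm⟩ : T3Family) n K x₀ ρ S ((ℓ + 1) * Mh) hM) → Matrix (Fin 2) (Fin 2) ℂ, (∀ c, ‖D' c‖ ≤ 4 * (64 * ((ℓ + 1 : ℕ) : ℝ) / (16 * 3800 * (((((PV 2 ℓ m K hd3 hL)).d + 2) * ((PV 2 ℓ m K hd3 hL)).L : ℕ) : ℝ) ^ 2 * ((ℓ + 1 : ℕ) : ℝ))⁻¹) * ε ^ 2) →
          chartLogFlat (((((ℓ + 1 : ℕ) : ℝ))⁻¹) ^ (K - n)) (cubeSeqMT3 (⟨ℓ + 1, hL, m, hm⟩ : T3Family) n K x₀ ρ S ((ℓ + 1) * Mh) hM) (A' - Hs D') - (fderiv ℂ (chartLogFlat (((((ℓ + 1 : ℕ) : ℝ))⁻¹) ^ (K - n)) (cubeSeqMT3 (⟨ℓ + 1, hL, m, hm⟩ : T3Family) n K x₀ ρ S ((ℓ + 1) * Mh) hM) : (PBond (PV 2 ℓ m K hd3 hL) 0 → Matrix (Fin 2) (Fin 2) ℂ) → BondIdx (cubeSeqMT3 (⟨ℓ + 1,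 hL, m, hm⟩ : T3Family) n K x₀ ρ S ((ℓ + 1) * Mh) hM) → Matrix (Fin 2) (Fin 2) ℂ) 0) (A' - Hs D') = D' → D' = Dsel A') ∧
        (∀ ρ' : ℝ, 0 ≤ ρ' → (∀ b, w 1 b * ‖A' b‖ ≤ ρ') → ∀ c, ‖Dsel A' c‖ ≤ 4 * (64 * ((ℓ + 1 : ℕ) : ℝ) / (16 * 3800 * (((((PV 2 ℓ m K hd3 hL)).d + 2) * ((PV 2 ℓ m K hd3 hL)).L : ℕ) : ℝ) ^ 2 * ((ℓ + 1 : ℕ) : ℝ))⁻¹) * ρ' ^ 2)) ∧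
      (∀ (Y : PBond (PV 2 ℓ m K hd3 hL) 0 → Matrix (Fin 2) (Fin 2) ℂ) (r : ℝ), r < ε → (∀ b, w 1 b * ‖Y b‖ ≤ r) → (∀ (b : PBond (PV 2 ℓ m K hd3 hL) 0) (ν : Fin 3), w 2 b * ((ℓ + 1 : ℕ) : ℝ) ^ (K - n) * ‖Y ⟨b.src.shift ν, b.dir⟩ - Y b‖ ≤ r) →
        ∀ c, ‖Dsel Y c‖ ≤ 4 * (64 * ((ℓ + 1 : ℕ) : ℝ) / (16 * 3800 * (((((PV 2 ℓ m K hd3 hL)).d + 2) * ((PV 2 ℓ m K hd3 hL)).L : ℕ) : ℝ) ^ 2 * ((ℓ + 1 : ℕ) : ℝ))⁻¹) * r ^ 2) ∧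
      (∀ (Y : PBond (PV 2 ℓ m K hd3 hL) 0 → Matrix (Fin 2) (Fin 2) ℂ) (r : ℝ), r < ε → (∀ b, w 1 b * ‖Y b‖ ≤ r) → (∀ (b : PBond (PV 2 ℓ m K hd3 hL) 0) (ν : Fin 3), w 2 b * ((ℓ + 1 : ℕ) : ℝ) ^ (K - n) * ‖Y ⟨b.src.shift ν, b.dir⟩ - Y b‖ ≤ r) →
        ∀ᶠ X in 𝓝 Y, Dsel X = (fun Z : PBond (PV 2 ℓ m K hd3 hL) 0 → Matrix (Fin 2) (Fin 2) ℂ => chartLogFlat (((((ℓ + 1 : ℕ) : ℝ))⁻¹) ^ (K - n)) (cubeSeqMT3 (⟨ℓ + 1, hL, m, hm⟩ : T3Family) n K x₀ ρ S ((ℓ + 1) * Mh) hM) Z - fderiv ℂ (chartLogFlat (((((ℓ + 1 : ℕ) : ℝ))⁻¹) ^ (K - n)) (cubeSeqMT3 (⟨ℓ + 1, hL, m, hm⟩ : T3Family) n K x₀ ρ S ((ℓ + 1) * Mh) hM) : (PBond (PV 2 ℓ m K hd3 hL) 0 → Matrix (Fin 2) (Fin 2) ℂ) → BondIdx (cubeSeqMT3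 (⟨ℓ + 1, hL, m, hm⟩ : T3Family) n K x₀ ρ S ((ℓ + 1) * Mh) hM) → Matrix (Fin 2) (Fin 2) ℂ) 0 Z) (X - Hs (Dsel X))) ∧
      (∀ (Y : PBond (PV 2 ℓ m K hd3 hL) 0 → Matrix (Fin 2) (Fin 2) ℂ) (r : ℝ), r < ε → (∀ b, w 1 b * ‖Y b‖ ≤ r) → (∀ (b : PBond (PV 2 ℓ m K hd3 hL) 0) (ν : Fin 3), w 2 b * ((ℓ + 1 : ℕ) : ℝ) ^ (K - n) * ‖Y ⟨b.src.shift ν, b.dir⟩ - Y b‖ ≤ r) →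
        DifferentiableAt ℂ Dsel Y) ∧
      (∀ (Y : PBond (PV 2 ℓ m K hd3 hL) 0 → Matrix (Fin 2) (Fin 2) ℂ) (r : ℝ), r < ε → (∀ b, w 1 b * ‖Y b‖ ≤ r) → (∀ (b : PBond (PV 2 ℓ m K hd3 hL) 0) (ν : Fin 3), w 2 b * ((ℓ + 1 : ℕ) : ℝ) ^ (K - n) * ‖Y ⟨b.src.shift ν, b.dir⟩ - Y b‖ ≤ r) →
        DifferentiableAt ℂ (fun Z : PBond (PV 2 ℓ m K hd3 hL) 0 → Matrix (Fin 2) (Fin 2) ℂ => chartLogFlat (((((ℓ + 1 : ℕ) : ℝ))⁻¹) ^ (K - n)) (cubeSeqMT3 (⟨ℓ + 1, hL, m, hm⟩ : T3Family) n K x₀ ρ S ((ℓ + 1) * Mh) hM) Z - fderiv ℂ (chartLogFlat (((((ℓ + 1 : ℕ) : ℝ))⁻¹) ^ (K - n)) (cubeSeqMT3 (⟨ℓ + 1, hL, m, hm⟩ : T3Family) n K x₀ ρ S ((ℓ + 1) * Mh) hM) : (PBond (PV 2 ℓ m K hd3 hL) 0 → Matrix (Fin 2) (Fin 2) ℂ)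 → BondIdx (cubeSeqMT3 (⟨ℓ + 1, hL, m, hm⟩ : T3Family) n K x₀ ρ S ((ℓ + 1) * Mh) hM) → Matrix (Fin 2) (Fin 2) ℂ) 0 Z) (Y - Hs (Dsel Y))) ∧
      (∀ A' : PBond (PV 2 ℓ m K hd3 hL) 0 → Matrix (Fin 2) (Fin 2) ℂ, (∀ b, w 1 b * ‖A' b‖ < ε) → ∀ ρ' : ℝ, 0 ≤ ρ' → (∀ b, w 1 b * ‖A' b‖ ≤ ρ') →
        ∀ (W : PBond (PV 2 ℓ m K hd3 hL) 0 → Matrix (Fin 2) (Fin 2) ℂ) (t : ℝ), 0 ≤ t → (∀ b, w 1 b * ‖W b‖ ≤ t) →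
          ∀ c, ‖fderiv ℂ Dsel A' W c‖ ≤ 9 * (64 * ((ℓ + 1 : ℕ) : ℝ) / (16 * 3800 * (((((PV 2 ℓ m K hd3 hL)).d + 2) * ((PV 2 ℓ m K hd3 hL)).L : ℕ) : ℝ) ^ 2 * ((ℓ + 1 : ℕ) : ℝ))⁻¹) * ρ' * (1 - 9 * (64 * ((ℓ + 1 : ℕ) : ℝ) / (16 * 3800 * (((((PV 2 ℓ m K hd3 hL)).d + 2) * ((PV 2 ℓ m K hd3 hL)).L : ℕ) : ℝ) ^ 2 * ((ℓ + 1 : ℕ) : ℝ))⁻¹) * BH * ε)⁻¹ * t) ∧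
      (∀ A δ : PBond (PV 2 ℓ m K hd3 hL) 0 → Matrix (Fin 2) (Fin 2) ℂ, fderiv ℂ (fun A : PBond (PV 2 ℓ m K hd3 hL) 0 → Matrix (Fin 2) (Fin 2) ℂ => (∑ p : Plaq (PV 2 ℓ m K hd3 hL) 0, (1 - (2 : ℂ)⁻¹ * Matrix.trace (exp ((Complex.I * ((((((ℓ + 1 : ℕ) : ℝ)⁻¹) ^ (K - n) : ℝ)) : ℂ)) • A ⟨p.src, p.μ⟩) * exp ((Complex.I * ((((((ℓ + 1 : ℕ) : ℝ)⁻¹) ^ (K - n) : ℝ)) : ℂ)) • A ⟨p.src.shift p.μ, p.ν⟩) * exp (-((Complex.I * ((((((ℓ + 1 : ℕ) : ℝ)⁻¹) ^ (K - n) : ℝ)) : ℂ)) • A ⟨p.src.shift p.ν, p.μ⟩)) * exp (-((Complex.I * ((((((ℓ + 1 : ℕ) : ℝ)⁻¹) ^ (K - n) : ℝ)) : ℂ)) • A ⟨p.src, p.ν⟩))) + (2 : ℂ)⁻¹ * Matrix.trace (((Complex.I * ((((((ℓ + 1 : ℕ) : ℝ)⁻¹) ^ (K - n) : ℝ)) :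 ℂ)) • A ⟨p.src, p.μ⟩) + ((Complex.I * ((((((ℓ + 1 : ℕ) : ℝ)⁻¹) ^ (K - n) : ℝ)) : ℂ)) • A ⟨p.src.shift p.μ, p.ν⟩) + (-((Complex.I * ((((((ℓ + 1 : ℕ) : ℝ)⁻¹) ^ (K - n) : ℝ)) : ℂ)) • A ⟨p.src.shift p.ν, p.μ⟩)) + (-((Complex.I * ((((((ℓ + 1 : ℕ) : ℝ)⁻¹) ^ (K - n) : ℝ)) : ℂ)) • A ⟨p.src, p.ν⟩))) + (4 : ℂ)⁻¹ * Matrix.trace ((((Complex.I * ((((((ℓ + 1 : ℕ) : ℝ)⁻¹) ^ (K - n) : ℝ)) : ℂ)) • A ⟨p.src, p.μ⟩) + ((Complex.I * ((((((ℓ + 1 : ℕ) : ℝ)⁻¹) ^ (K - n) : ℝ)) : ℂ)) • A ⟨p.src.shift p.μ, p.ν⟩) + (-((Complex.I * ((((((ℓ + 1 : ℕ) : ℝ)⁻¹) ^ (K - n) : ℝ)) : ℂ)) • A ⟨p.src.shift p.ν, p.μ⟩)) + (-((Complex.I * ((((((ℓ + 1 : ℕ) : ℝ)⁻¹) ^ (K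 - n) : ℝ)) : ℂ)) • A ⟨p.src, p.ν⟩))) ^ 2)))) A δ =
        (((((ℓ + 1 : ℕ) : ℝ)⁻¹) ^ (K - n) : ℝ) : ℂ) ^ 4 * ∑ b : PBond (PV 2 ℓ m K hd3 hL) 0, Matrix.trace (W₀ A b * δ b)) ∧
      Differentiable ℂ W₀ ∧
      ∀ E : (PBond (PV 2 ℓ m K hd3 hL) 0 → Matrix (Fin 2) (Fin 2) ℂ) → (PBond (PV 2 ℓ m K hd3 hL) 0 → Matrix (Fin 2) (Fin 2) ℂ),
        (∀ (Y : PBond (PV 2 ℓ m K hd3 hL) 0 → Matrix (Fin 2) (Fin 2) ℂ) (b : PBond (PV 2 ℓ m K hd3 hL) 0) (i j : Fin 2), E Y b i j = (((((((ℓ + 1 : ℕ) : ℝ)⁻¹) ^ (K - n)) : ℝ) : ℂ) ^ 4)⁻¹ *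
          (-((((((((ℓ + 1 : ℕ) : ℝ)⁻¹) ^ (K - n)) : ℝ) : ℂ) ^ 2 / 2) * ∑ p : Plaq (PV 2 ℓ m K hd3 hL) 0, Matrix.trace ((Hs (Dsel Y) ⟨p.src, p.μ⟩ + Hs (Dsel Y) ⟨p.src.shift p.μ, p.ν⟩ - Hs (Dsel Y) ⟨p.src.shift p.ν, p.μ⟩ - Hs (Dsel Y) ⟨p.src, p.ν⟩) *
              (((Pi.single b (Matrix.single j i (1 : ℂ)) : PBond (PV 2 ℓ m K hd3 hL) 0 → Matrix (Fin 2) (Fin 2) ℂ)) ⟨p.src, p.μ⟩ + ((Pi.single b (Matrix.single j i (1 : ℂ)) : PBond (PV 2 ℓ m K hd3 hL) 0 → Matrix (Fin 2) (Fin 2) ℂ)) ⟨p.src.shift p.μ, p.ν⟩ -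
                ((Pi.single b (Matrix.single j i (1 : ℂ)) : PBond (PV 2 ℓ m K hd3 hL) 0 → Matrix (Fin 2) (Fin 2) ℂ)) ⟨p.src.shift p.ν, p.μ⟩ - ((Pi.single b (Matrix.single j i (1 : ℂ)) : PBond (PV 2 ℓ m K hd3 hL) 0 → Matrix (Fin 2) (Fin 2) ℂ)) ⟨p.src, p.ν⟩)))
            - (((((((ℓ + 1 : ℕ) : ℝ)⁻¹) ^ (K - n)) : ℝ) : ℂ) ^ 2 / 2) * ∑ p : Plaq (PV 2 ℓ m K hd3 hL) 0, Matrix.trace (((Y - Hs (Dsel Y)) ⟨p.src, p.μ⟩ + (Y - Hs (Dsel Y)) ⟨p.src.shift p.μ, p.ν⟩ - (Y - Hs (Dsel Y)) ⟨p.src.shift p.ν, p.μ⟩ - (Y - Hs (Dsel Y)) ⟨p.src, p.ν⟩) *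
              (Hs (fderiv ℂ Dsel Y (Pi.single b (Matrix.single j i (1 : ℂ)))) ⟨p.src, p.μ⟩ + Hs (fderiv ℂ Dsel Y (Pi.single b (Matrix.single j i (1 : ℂ)))) ⟨p.src.shift p.μ, p.ν⟩ -
                Hs (fderiv ℂ Dsel Y (Pi.single b (Matrix.single j i (1 : ℂ)))) ⟨p.src.shift p.ν, p.μ⟩ - Hs (fderiv ℂ Dsel Y (Pi.single b (Matrix.single j i (1 : ℂ)))) ⟨p.src, p.ν⟩))
            - ((((((ℓ + 1 : ℕ) : ℝ)⁻¹) ^ (K - n)) : ℝ) : ℂ) ^ 4 * ∑ b' : PBond (PV 2 ℓ m K hd3 hL) 0, Matrix.trace (W₀ (Y - Hs (Dsel Y)) b' * Hs (fderiv ℂ Dsel Y (Pi.single b (Matrix.single j i (1 : ℂ)))) b'))) →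
        ∀ (Y : PBond (PV 2 ℓ m K hd3 hL) 0 → Matrix (Fin 2) (Fin 2) ℂ) (r : ℝ), r < a₃ → (∀ b, w 1 b * ‖Y b‖ ≤ r) →
          (∀ (b : PBond (PV 2 ℓ m K hd3 hL) 0) (ν : Fin 3), w 2 b * ((ℓ + 1 : ℕ) : ℝ) ^ (K - n) * ‖Y ⟨b.src.shift ν, b.dir⟩ - Y b‖ ≤ r) →
          ∀ b, w 3 b * ‖(W₀ (Y - Hs (Dsel Y)) + E Y) b‖ ≤
            (12 * (((ℓ + 1 : ℕ) : ℝ) ^ 3 * (1428 + ((ℓ + 1 : ℕ) : ℝ))) * (1 + 4 * BH * (64 * ((ℓ + 1 : ℕ) : ℝ) / (16 * 3800 * (((((PV 2 ℓ m K hd3 hL)).d + 2) * ((PV 2 ℓ m K hd3 hL)).L : ℕ) : ℝ) ^ 2 * ((ℓ + 1 : ℕ) : ℝ))⁻¹) * Rc₀) ^ 2 +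
              (2 * CX * (64 * ((ℓ + 1 : ℕ) : ℝ) / (16 * 3800 * (((((PV 2 ℓ m K hd3 hL)).d + 2) * ((PV 2 ℓ m K hd3 hL)).L : ℕ) : ℝ) ^ 2 * ((ℓ + 1 : ℕ) : ℝ))⁻¹) + 2⁻¹ * (8 * (7 * C₃ * (1 + 4 * BH * (64 * ((ℓ + 1 : ℕ) : ℝ) / (16 * 3800 * (((((PV 2 ℓ m K hd3 hL)).d + 2) * ((PV 2 ℓ m K hd3 hL)).L : ℕ) : ℝ) ^ 2 * ((ℓ + 1 : ℕ) : ℝ))⁻¹) * ε)) * (2 * CP)) * (1 + 4 * BH * (64 * ((ℓ + 1 : ℕ) : ℝ) / (16 * 3800 * (((((PV 2 ℓ m K hd3 hL)).d + 2) * ((PV 2 ℓ m K hd3 hL)).L : ℕ) : ℝ) ^ 2 * ((ℓ + 1 : ℕ) : ℝ))⁻¹) * Rc₀) +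
                (16 * K₀ * (7 * C₃ * (1 + 4 * BH * (64 * ((ℓ + 1 : ℕ) : ℝ) / (16 * 3800 * (((((PV 2 ℓ m K hd3 hL)).d + 2) * ((PV 2 ℓ m K hd3 hL)).L : ℕ) : ℝ) ^ 2 * ((ℓ + 1 : ℕ) : ℝ))⁻¹) * ε))) * Rc₀ * (12 * (((ℓ + 1 : ℕ) : ℝ) ^ 3 * (1428 + ((ℓ + 1 : ℕ) : ℝ)))) * (1 + 4 * BH * (64 * ((ℓ + 1 : ℕ) : ℝ) / (16 * 3800 * (((((PV 2 ℓ m K hd3 hL)).d + 2) * ((PV 2 ℓ m K hd3 hL)).L : ℕ) : ℝ) ^ 2 * ((ℓ + 1 : ℕ) : ℝ))⁻¹) * Rc₀) ^ 2)) * r ^ 2 := by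
  obtain ⟨Mh₀, R₀, BH, CX, K₀, CP, hBH, hCX, hK₀, hCP, hE⟩ := exists_hWq_dressed_cubeSeq_T3_chartOfRecord ℓ hL hℓ
  refine ⟨Mh₀, max R₀ (2 * (ℓ + 1)), BH, CX, K₀, CP, hBH, hCX, hK₀, hCP, fun C₃ R' hC₃ hR'0 hR'le => ?_⟩
  -- (S3)'s constants at this `L`
  have hL0 : (0 : ℝ) < ((ℓ + 1 : ℕ) : ℝ) := by positivity
  have hC₂0 : (0 : ℝ) ≤ (64 * ((ℓ + 1 : ℕ) : ℝ) / (16 * 3800 * ((((2 + 1 + 2) * (ℓ + 1) : ℕ)) : ℝ) ^ 2 * ((ℓ + 1 : ℕ) : ℝ))⁻¹) := by positivity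
  obtain ⟨ε, Rc₀, a₃, ha₃, hε, h3ε, hq, hR', hsmall, hRc0, hRcε, ha₃R, hθ⟩ :=
    exists_CE_window (C₃ := 7 * C₃) hR'0 hR'le hC₂0 hBH hK₀ (by positivity) hL0
  refine ⟨ε, Rc₀, a₃, ha₃, ha₃R, hRcε, h3ε, hq, hR', hθ, ?_⟩
  intro m hm n K hk1 hk' Mh R a' hMha hMh hR hsize x₀ ρ S hM hRS w hw hKball
  have hR₀ : R₀ ≤ R := le_trans (le_max_left _ _) hR
  have hR2L : 2 * (ℓ + 1) ≤ R := le_trans (le_max_right _ _) hR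
  have hAdm : Adm22 (cubeSeqMT3 (⟨ℓ + 1, hL, m, hm⟩ : T3Family) n K x₀ ρ S ((ℓ + 1) * Mh) hM) R ((ℓ + 1) * Mh) := adm22_cubeSeqMT3 (⟨ℓ + 1, hL, m, hm⟩ : T3Family) n K x₀ ρ hM hRS
  have hDk : (cubeSeqMT3 (⟨ℓ + 1, hL, m, hm⟩ : T3Family) n K x₀ ρ S ((ℓ + 1) * Mh) hM).k = K - n := cubeSeqMT3_k (⟨ℓ + 1, hL, m, hm⟩ : T3Family) n K x₀ ρ S ((ℓ + 1) * Mh) hM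
  have hRL : 2 * ((⟨ℓ + 1, hL, m, hm⟩ : T3Family).P K).L ≤ R := by
    show 2 * (ℓ + 1) ≤ R
    exact hR2L
  -- (S3) B3: the chart is differentiable on the `Rs/4`-ball; (S4) v1.2: the column letter on the ball from the read-kernel row
  obtain ⟨hdiff, -⟩ := chartRemainderFlat_hCd_hCq_B1 (⟨ℓ + 1, hL, m, hm⟩ : T3Family) n K hRL hM (cubeSeqMT3 (⟨ℓ + 1, hL, m, hm⟩ : T3Family) n K x₀ ρ S ((ℓ + 1) * Mh) hM) hDk hAdm hw
  have hball := hCcolFlatBall_of_readKernel157 (⟨ℓ + 1, hL, m, hm⟩ : T3Family) n K (cubeSeqMT3 (⟨ℓ + 1, hL, m, hm⟩ : T3Family) n K x₀ ρ S ((ℓ + 1) * Mh) hM) hDk hw (C₃ := C₃) (R := (16 * 3800 * (((((PV 2 ℓ m K hd3 hL)).d + 2) * ((PV 2 ℓ m K hd3 hL)).L : ℕ) : ℝ) ^ 2 * ((ℓ + 1 : ℕ) : ℝ))⁻¹ / 4) (R' := R')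
    hC₃ hR'le hdiff hKball
  have h7 : (0 : ℝ) ≤ 7 * C₃ := by positivity
  have hu : ∀ c : BondIdx (cubeSeqMT3 (⟨ℓ + 1, hL, m, hm⟩ : T3Family) n K x₀ ρ S ((ℓ + 1) * Mh) hM), ((((ℓ + 1 : ℕ) : ℝ)) ^ (K - n)) ^ 3 * ((((ℓ + 1 : ℕ) : ℝ)) ^ (c.1.1 : ℕ) * ((((ℓ + 1 : ℕ) : ℝ))⁻¹) ^ (K - n))⁻¹ ≤ (fun i : BondIdx (cubeSeqMT3 (⟨ℓ + 1, hL, m, hm⟩ : T3Family) n K x₀ ρ S ((ℓ + 1) * Mh) hM) => ((((((ℓ + 1 : ℕ) : ℝ))⁻¹) ^ (K - n)) ^ 3)⁻¹ * (((((ℓ + 1 : ℕ) : ℝ)) ^ (i.1.1 : ℕ) * ((((ℓ + 1 : ℕ) : ℝ))⁻¹) ^ (K - n)))⁻¹) c := fun c => by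
    show ((((ℓ + 1 : ℕ) : ℝ)) ^ (K - n)) ^ 3 * ((((ℓ + 1 : ℕ) : ℝ)) ^ (c.1.1 : ℕ) * ((((ℓ + 1 : ℕ) : ℝ))⁻¹) ^ (K - n))⁻¹ ≤ ((((((ℓ + 1 : ℕ) : ℝ))⁻¹) ^ (K - n)) ^ 3)⁻¹ * (((((ℓ + 1 : ℕ) : ℝ)) ^ (c.1.1 : ℕ) * ((((ℓ + 1 : ℕ) : ℝ))⁻¹) ^ (K - n)))⁻¹
    rw [inv_pow, inv_pow, inv_inv]
  exact hE m hm n K hk1 hk' hMha hMh hR₀ hsize x₀ ρ S hM hRS w hw (fun i : BondIdx (cubeSeqMT3 (⟨ℓ + 1, hL, m, hm⟩ : T3Family) n K x₀ ρ S ((ℓ + 1) * Mh) hM) => ((((((ℓ + 1 : ℕ) : ℝ))⁻¹) ^ (K - n)) ^ 3)⁻¹ * (((((ℓ + 1 : ℕ) : ℝ)) ^ (i.1.1 : ℕ) * ((((ℓ + 1 : ℕ) : ℝ))⁻¹) ^ (K - n)))⁻¹) hu hε h3ε hq h7 hR' hball hsmall hRc0 hRcε ha₃R hθ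

end Summit.QuantumFields.YangMills.Theorems.HalvingDressingLetter

end
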